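import Summits.QuantumFields.YangMills.Theorems.BalabanUVNodesN11GaussianCertificateRows
import Literature.MathematicalPhysics.QuantumFieldTheory.Balaban1983to89.Node00.Record13SepCoPHChi
import Literature.MathematicalPhysics.QuantumFieldTheory.Balaban1983to89.Node00.Record13ResidualsRChi
import Summits.QuantumFields.YangMills.Theorems.BalabanUVNodesN11HistoryPinnedResidualDefsChi
import Summits.QuantumFields.YangMills.Theorems.BalabanUVNodesN11RePinnedParamDefsChi
import Summits.QuantumFields.YangMills.Theorems.BalabanUVNodesN11BackgroundScaleLocalChi
import Summits.QuantumFields.YangMills.Theorems.BalabanUVNodesN11NoExpansionAtRecord13CoPChi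
import Summits.QuantumFields.YangMills.Theorems.BalabanUVNodesN11NoExpansionDiagonalCoPHChi
import Summits.QuantumFields.YangMills.Theorems.BalabanUVNodesN11NoExpansionOldFactorsChi
import Summits.QuantumFields.YangMills.Theorems.BalabanUVNodesN11NoExpansionGeneralStepCoPHOldBranchChi
import Summits.QuantumFields.YangMills.Theorems.BalabanUVNodesN11NoExpansionGeneralStepGraphChi
import Summits.QuantumFields.YangMills.Theorems.BalabanUVNodesN11DiagonalOldBranchMeasurableChi
import Summits.QuantumFields.YangMills.Theorems.BalabanUVNodesN11OldBranchPairChi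
import Summits.QuantumFields.YangMills.Theorems.BalabanUVNodesN11TruncationDominationChi

/-!
# χ-GENERIC RE-ISSUE (WORK ORDER RC-1 «RE-CENTRE THE RECORD», director-ym №462 (B) ∕ №467 (D)) of `BalabanUVNodesN11GaussianCertificateRows`

Cell `pub-ymgap` (HUMAN RULING D-0062, Track A), seat `pub-ymgap-dag-n11-d` (N11 [B14] s2; N11-σ campaign, `N11-G44-RC1-REACH-CENSUS.md`).  The CENTRE-TYPED
declarations of `BalabanUVNodesN11GaussianCertificateRows` (those whose statement reads the (2.9) cut-off centre through `gOfRecord₁₃ ∕ EOfRecord₁₃ ∕ Provisos₁₃… ∕ T∕SLaw₁₃… ∕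
UbgOfRecord₁₃… ∕ WtOfRecord₁₃… ∕ datum∕tower∕coreOfRecord₁₃…`) RE-ISSUED VERBATIM in the β-slot `χ : ChiSlot F N` over [Ax-3b]∕[Ax-3c]∕[Ax-3d]'s χ-generic carriers
(`Node00/Record13Chi` ∕ `Record13CoPHChi` ∕ `Record13SepCoPHChi`): σ = (binder `(χ : ChiSlot F N)` after `θ`; Node00 defs `X ↦ XChi … χ`; Node00 rows `Y ↦ Y_chi`;
this lane's sibling modules `…Chi` for Summits-side dependencies); SAME short names in the sibling namespace `…BalabanUVNodesN11GaussianCertificateRowsChi` (consumers switch by namespace);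
the 13 centre-FREE declarations of the original are NOT copied — they are reused BY NAME (`open … (…)` below).  At `χ := chiβOfRecord₁₃ θ` every statement here is
DEFINITIONALLY the landed one ([Ax-3b]'s `rfl` receipts); at `χ := chiβOfRecord₁₃Ax θ` it is what the Ax-record's N11 machine reads.  Nothing of record edited (body-freeze №460 (2)).

HONEST FRAMING.  Count-neutral kernel re-elaboration of landed N11 bookkeeping∕estimates in a parameter; every HYPOTHESIS of the original stays a hypothesis; nothing of
Bałaban asserted beyond what the original file proves; N11 NOT discharged; K-items untouched; counts unmoved.  One finite `𝕋⁴_{L^K}` programme at fixed `ε = L^{−K}` —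
NOT ℝ⁴, NOT OS, NOT a mass gap, NOT Clay.  No `sorry`∕`instance`∕`notation`.  Sources: as the original module, plus [I] = [Balaban1987RG1] (2.9) p.266 (the cut-off's centre).
-/

noncomputable section

open MeasureTheory
open scoped BigOperators ENNReal NNReal Matrix.Norms.L2Operator

namespace Summit.QuantumFields.YangMills.Theorems.BalabanUVNodesN11GaussianCertificateRowsChi

open Summit.QuantumFields.YangMills.Theorems.BalabanUVNodesN11GaussianCertificateRows (zhAt_ζ0_eq_rePinH zhAt_quad_apply coercive_of_gaussCert prefix_agree_of_gaussCert ζ0_pin_of_gaussCert quad_empty_pairCfgAt_of_gaussCert quad_local_of_gaussCert measurable_ζ0_of_gaussCert measurable_quad_of_gaussCert exists_local_witness_clause_succ_of_sLaw₁₃CoPH_of_gaussCert exists_local_witness_clause_succ_of_sLaw₁₃CoPH_of_gaussCert_of_termRows noExpansionTStepAt_of_gaussCert_of_operandRows exists_gaussCert_of_antecedent)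
open Literature.MathematicalPhysics.QuantumFieldTheory.Balaban1983to89 T4Continuum Node00 Node00.Tk
open B10Eq42TorusConstraint (bondsIn)
open BalabanUVNodesN11RePinnedParamDefs hiding rePinH zhAt_rePinH zhAt_rePinH_eq_init_of_Omega_empty zhAt_rePinH_ζ0_univ_pairCfgAt zhUnity_rePinH
open BalabanUVNodesN11RePinnedParamDefsChi
open BalabanUVNodesN11HistoryPinnedResidualDefsChi (ZhPinOfRecord₁₃ laws_ZhPinOfRecord₁₃ localLaws_ZhPinOfRecord₁₃)
open BalabanUVNodesN11RePinnedOldBranchMeasurable (measurable_zhAt_ζ0_rePinH_of_provisos)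
open BalabanUVNodesN11FluctTruncationDefs (IsFluctLocal)
open BalabanUVNodesN11Sect3SupplyDefs (NoExpansionTStepAt)
open BalabanUVNodesN11NoExpansionStepSpecification (exists_local_witness_clause_succ_of_sLaw₁₃CoPH_of_rows)
open BalabanUVNodesN11AFibreDominationOfCoercive (afibre_rows_adm_of_coercive)
open BalabanUVNodesN11NoExpansionStepSpecificationOfCoercive (exists_local_witness_clause_succ_of_sLaw₁₃CoPH_of_coercive_of_termRows)
open B15DeterminingSets (MSField)

variable {F : T4Family} {N : ℕ} [NeZero N]

/-! ## §1  The residual rows of the specification hold for every parameter of the Gaussian certificate class -/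

section Rows

variable (θ : Stage13HParams F N) (χ : ChiSlot F N) (p : B12.RunParams)

/-- **PRINT'S PARTITION OF UNITY** holds in the class (the certificate's `ζ0`, dag-n11-d's `zhUnity_rePinH`). [cite: Balaban1988Convergent, (3.16)–(3.20) pp.268–269] -/
theorem zhUnity_of_gaussCert (hζ : ∀ (p : B12.RunParams) (n : ℕ) (Ω Λ : ℕ → Set (Site (F.P p.K) 0)), (θ.Zh p n Ω Λ).ζ0 = (ZhPinOfRecord₁₃ θ.toStage13Params χ p Ω Λ).ζ0) :
    θ.ZhUnity F N := by
  intro p n Ω Λ j ω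
  rw [hζ p n Ω Λ]
  exact zhUnity_rePinH (θ := θ) (χ := χ) p n Ω Λ j ω

end Rows

/-! ## §2  ★★★ Hence the no-expansion 𝐓-step for the class: ALL residual rows discharged, def-T's operand rows only -/

section Step

variable (θ : Stage13HParams F N) (χ : ChiSlot F N) (p : B12.RunParams)

end Step

/-! ## §3  ★★ The class is inhabited from every parameter carrying the K⁷ antecedent, which transfers -/

section Transfer

variable (θ : Stage13HParams F N) (χ : ChiSlot F N)

end Transfer

/-! ## v1.1 (APPEND-ONLY; dag-n11-d g44, N11-σ chain): the remaining cone declarations of this module in χ — every v1 declaration above is byte-identical -/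

section V11Append

open Summit.QuantumFields.YangMills.Theorems.BalabanUVNodesN11GaussianCertificateRows (exists_local_witness_clause_succ_of_sLaw₁₃CoPH_of_gaussCert exists_local_witness_clause_succ_of_sLaw₁₃CoPH_of_gaussCert_of_termRows noExpansionTStepAt_of_gaussCert_of_operandRows exists_gaussCert_of_antecedent)
open BalabanUVNodesN11RePinnedOldBranchMeasurableChi (measurable_zhAt_ζ0_rePinH_of_provisos)

section
variable {F : T4Family} {N : ℕ} [NeZero N]
variable (θ : Stage13HParams F N) (χ : ChiSlot F N) (p : B12.RunParams)

/-- The residual factor serving any history IS the certificate's (`hζ`). [cite: Balaban1988Convergent, (3.16)–(3.20) pp.268–269 (bookkeeping)] -/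
theorem zhAt_ζ0_eq_rePinH (hζ : ∀ (p : B12.RunParams) (n : ℕ) (Ω Λ : ℕ → Set (Site (F.P p.K) 0)), (θ.Zh p n Ω Λ).ζ0 = (ZhPinOfRecord₁₃ θ.toStage13Params χ p Ω Λ).ζ0)
    {n : ℕ} (s : SeqOfRecord F θ.ν θ.τ9.M (gOfRecord₁₃Chi F N θ.toStage13Params χ p) p.K n) : (θ.zhAtChi χ p s).ζ0 = ((rePinH θ χ).zhAtChi χ p s).ζ0 :=
  hζ p n s.Ω s.Λ

end

section
variable {F : T4Family} {N : ℕ} [NeZero N]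
variable (θ : Stage13HParams F N) (χ : ChiSlot F N) (p : B12.RunParams)

/-- The form serving any history is the Gaussian of the integrated variables (`hq`). [cite: Balaban1988Convergent, (2.21) p.258 (bookkeeping)] -/
theorem zhAt_quad_apply
    (hq : ∀ (p : B12.RunParams) (n : ℕ) (Ω Λ : ℕ → Set (Site (F.P p.K) 0)) (j : ℕ) (Λ' : Set (Site (F.P p.K) 0)) (ω : MultiCfg (F.P p.K) (SU N) (FluctV N)),
      (θ.Zh p n Ω Λ).quad j Λ' ω = ∑ b ∈ (Set.toFinite (bondsIn j (Λ'ᶜ ∩ Ω (j + 1)))).toFinset, ‖(ω j).2 b‖ ^ 2)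
    {n : ℕ} (s : SeqOfRecord F θ.ν θ.τ9.M (gOfRecord₁₃Chi F N θ.toStage13Params χ p) p.K n) (j : ℕ) (Λ' : Set (Site (F.P p.K) 0)) (ω : MultiCfg (F.P p.K) (SU N) (FluctV N)) :
    (θ.zhAtChi χ p s).quad j Λ' ω = ∑ b ∈ (Set.toFinite (bondsIn j (Λ'ᶜ ∩ s.Ω (j + 1)))).toFinset, ‖(ω j).2 b‖ ^ 2 :=
  hq p n s.Ω s.Λ j Λ' ω

end

section
variable {F : T4Family} {N : ℕ} [NeZero N]
variable (θ : Stage13HParams F N) (χ : ChiSlot F N) (p : B12.RunParams)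

/-- **★ COERCIVITY WITH CONSTANT `1` AT EVERY HISTORY AND GENERATION**: the A-fibre bonds of `init s′` (in `Λ_{j+1}(init s′)ᶜ ∩ Ω_{j+1}(init s′)`) are among the bonds of
`Λ_{j+1}(init s′)ᶜ ∩ Ω_{j+1}(s′)` summed by the Gaussian serving `s′` (`Ω_{j+1}(init s′) ⊆ Ω_{j+1}(s′)`: equal below the top, empty above) — the hypothesis `hcoer` of
dag-n11-w4's `afibre_rows_adm_of_coercive`. [cite: Balaban1988Convergent, (2.21) p.258, (2.1) p.254; Balaban1987RG1, (1.4)–(1.5) pp.260–261] -/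
theorem coercive_of_gaussCert
    (hq : ∀ (p : B12.RunParams) (n : ℕ) (Ω Λ : ℕ → Set (Site (F.P p.K) 0)) (j : ℕ) (Λ' : Set (Site (F.P p.K) 0)) (ω : MultiCfg (F.P p.K) (SU N) (FluctV N)),
      (θ.Zh p n Ω Λ).quad j Λ' ω = ∑ b ∈ (Set.toFinite (bondsIn j (Λ'ᶜ ∩ Ω (j + 1)))).toFinset, ‖(ω j).2 b‖ ^ 2)
    {k : ℕ} (s : SeqOfRecord F θ.ν θ.τ9.M (gOfRecord₁₃Chi F N θ.toStage13Params χ p) p.K (k + 1)) (j : ℕ) :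
    ∃ c : ℝ, 0 < c ∧ ∀ ω : MultiCfg (F.P p.K) (SU N) (FluctV N),
      c * ∑ b ∈ (Set.toFinite (bondsIn j ((s.init.Λ (j + 1))ᶜ ∩ s.init.Ω (j + 1)))).toFinset, ‖(ω j).2 b‖ ^ 2 ≤ (θ.zhAtChi χ p s).quad j (s.init.Λ (j + 1)) ω := by
  refine ⟨1, one_pos, fun ω => ?_⟩
  rw [one_mul, zhAt_quad_apply θ χ p hq]
  have hΩ : s.init.Ω (j + 1) ⊆ s.Ω (j + 1) := by
    by_cases hj : j + 1 ≤ k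
    · exact (seq_init_Ω_of_le s hj).le
    · rw [s.init.Ω_off (j + 1) (fun h => hj h.2)]; exact Set.empty_subset _
  refine Finset.sum_le_sum_of_subset_of_nonneg (fun b hb => ?_) fun _ _ _ => by positivity
  rw [Set.Finite.mem_toFinset] at hb ⊢
  exact B10Eq42TorusConstraint.bondsIn_mono (Set.inter_subset_inter_right _ hΩ) hb

end

section
variable {F : T4Family} {N : ℕ} [NeZero N]
variable (θ : Stage13HParams F N) (χ : ChiSlot F N) (p : B12.RunParams)

/-- **(P) PREFIX AGREEMENT** at a no-expansion history: `ζ0` by dag-n11-d's `zhAt_rePinH_eq_init_of_Omega_empty`, `quad_j` (`j < k`) because it reads `Ω_{j+1}` only.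
[cite: Balaban1988Convergent, p.257, (2.1) p.254 (bookkeeping)] -/
theorem prefix_agree_of_gaussCert
    (hζ : ∀ (p : B12.RunParams) (n : ℕ) (Ω Λ : ℕ → Set (Site (F.P p.K) 0)), (θ.Zh p n Ω Λ).ζ0 = (ZhPinOfRecord₁₃ θ.toStage13Params χ p Ω Λ).ζ0)
    (hq : ∀ (p : B12.RunParams) (n : ℕ) (Ω Λ : ℕ → Set (Site (F.P p.K) 0)) (j : ℕ) (Λ' : Set (Site (F.P p.K) 0)) (ω : MultiCfg (F.P p.K) (SU N) (FluctV N)),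
      (θ.Zh p n Ω Λ).quad j Λ' ω = ∑ b ∈ (Set.toFinite (bondsIn j (Λ'ᶜ ∩ Ω (j + 1)))).toFinset, ‖(ω j).2 b‖ ^ 2)
    {k : ℕ} (s : SeqOfRecord F θ.ν θ.τ9.M (gOfRecord₁₃Chi F N θ.toStage13Params χ p) p.K (k + 1)) (hΩ : s.Ω (k + 1) = ∅) :
    ∀ j, j < k → (θ.zhAtChi χ p s).ζ0 j = (θ.zhAtChi χ p s.init).ζ0 j ∧ (θ.zhAtChi χ p s).quad j = (θ.zhAtChi χ p s.init).quad j := by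
  intro j hj
  constructor
  · rw [zhAt_ζ0_eq_rePinH θ χ p hζ s, zhAt_ζ0_eq_rePinH θ χ p hζ s.init, zhAt_rePinH_eq_init_of_Omega_empty θ p s hΩ]
  · funext Λ' ω
    rw [zhAt_quad_apply θ χ p hq, zhAt_quad_apply θ χ p hq, seq_init_Ω_of_le s (Nat.succ_le_of_lt hj)]

end

section
variable {F : T4Family} {N : ℕ} [NeZero N]
variable (θ : Stage13HParams F N) (χ : ChiSlot F N) (p : B12.RunParams)

/-- **(V) THE GENERATION-`k` PIN** at a no-expansion history (the certificate's `ζ0`; dag-n11-d's `zhAt_rePinH_ζ0_univ_pairCfgAt`).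
[cite: Balaban1988Convergent, (2.21) p.258, (3.16) p.268, (3.24)–(3.25) p.270] -/
theorem ζ0_pin_of_gaussCert
    (hζ : ∀ (p : B12.RunParams) (n : ℕ) (Ω Λ : ℕ → Set (Site (F.P p.K) 0)), (θ.Zh p n Ω Λ).ζ0 = (ZhPinOfRecord₁₃ θ.toStage13Params χ p Ω Λ).ζ0)
    {k : ℕ} (hk : k < p.K) (s : SeqOfRecord F θ.ν θ.τ9.M (gOfRecord₁₃Chi F N θ.toStage13Params χ p) p.K (k + 1)) (hΩ : s.Ω (k + 1) = ∅)
    (V' : GaugeField (F.P p.K) (k + 1) (SU N)) (U₀ : GaugeField (F.P p.K) k (SU N)) :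
    (θ.zhAtChi χ p s).ζ0 k Set.univ (pairCfgAt (V := FluctV N) k V' U₀) =
      chiSeqOfRecord F N θ.ν θ.τ9.M (gOfRecord₁₃Chi F N θ.toStage13Params χ p) p.K k s.init U₀ *
        wOfRecord₉ F N θ.toStage9Params p (gOfRecord₁₃Chi F N θ.toStage13Params χ p) k s U₀ ((avOfRecord F N p.K k).avg U₀) := by
  rw [zhAt_ζ0_eq_rePinH θ χ p hζ s]
  exact zhAt_rePinH_ζ0_univ_pairCfgAt θ p hk s hΩ V' U₀

end

section
variable {F : T4Family} {N : ℕ} [NeZero N]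
variable (θ : Stage13HParams F N) (χ : ChiSlot F N) (p : B12.RunParams)

/-- **`quad_k(∅) = 0` ON THE TWO-SCALE CONFIGURATIONS**: they have zero fluctuation variables (def-T's `pairCfgAt_snd`). [cite: Balaban1988Convergent, (2.21)–(2.22) p.258] -/
theorem quad_empty_pairCfgAt_of_gaussCert
    (hq : ∀ (p : B12.RunParams) (n : ℕ) (Ω Λ : ℕ → Set (Site (F.P p.K) 0)) (j : ℕ) (Λ' : Set (Site (F.P p.K) 0)) (ω : MultiCfg (F.P p.K) (SU N) (FluctV N)),
      (θ.Zh p n Ω Λ).quad j Λ' ω = ∑ b ∈ (Set.toFinite (bondsIn j (Λ'ᶜ ∩ Ω (j + 1)))).toFinset, ‖(ω j).2 b‖ ^ 2)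
    {k : ℕ} (s : SeqOfRecord F θ.ν θ.τ9.M (gOfRecord₁₃Chi F N θ.toStage13Params χ p) p.K (k + 1))
    (V' : GaugeField (F.P p.K) (k + 1) (SU N)) (U₀ : GaugeField (F.P p.K) k (SU N)) :
    (θ.zhAtChi χ p s).quad k ∅ (pairCfgAt (V := FluctV N) k V' U₀) = 0 := by
  rw [zhAt_quad_apply θ χ p hq]
  refine Finset.sum_eq_zero fun b _ => ?_
  rw [pairCfgAt_snd]
  simp

end

section
variable {F : T4Family} {N : ℕ} [NeZero N]
variable (θ : Stage13HParams F N) (χ : ChiSlot F N) (p : B12.RunParams)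

/-- **`k`-LOCALITY OF `quad_j`**, `j < k`: it reads the generation-`j` fluctuation variables only. [cite: Balaban1988Convergent, (2.21) p.258 (bookkeeping)] -/
theorem quad_local_of_gaussCert
    (hq : ∀ (p : B12.RunParams) (n : ℕ) (Ω Λ : ℕ → Set (Site (F.P p.K) 0)) (j : ℕ) (Λ' : Set (Site (F.P p.K) 0)) (ω : MultiCfg (F.P p.K) (SU N) (FluctV N)),
      (θ.Zh p n Ω Λ).quad j Λ' ω = ∑ b ∈ (Set.toFinite (bondsIn j (Λ'ᶜ ∩ Ω (j + 1)))).toFinset, ‖(ω j).2 b‖ ^ 2)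
    {k : ℕ} (s : SeqOfRecord F θ.ν θ.τ9.M (gOfRecord₁₃Chi F N θ.toStage13Params χ p) p.K (k + 1)) :
    ∀ j, j < k → ∀ ω ω' : MultiCfg (F.P p.K) (SU N) (FluctV N), (∀ i, i ≤ k → ω i = ω' i) →
      (θ.zhAtChi χ p s).quad j (s.init.Λ (j + 1)) ω = (θ.zhAtChi χ p s).quad j (s.init.Λ (j + 1)) ω' := by
  intro j hj ω ω' hωω'
  rw [zhAt_quad_apply θ χ p hq, zhAt_quad_apply θ χ p hq, hωω' j hj.le]

end

section
variable {F : T4Family} {N : ℕ} [NeZero N]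
variable (θ : Stage13HParams F N) (χ : ChiSlot F N) (p : B12.RunParams)

/-- **MEASURABILITY OF `ζ0`** in the class from the core provisos (dag-n11-d's `measurable_zhAt_ζ0_rePinH_of_provisos`). [cite: Balaban1988Convergent, (3.16)–(3.20) pp.268–269 (bookkeeping)] -/
theorem measurable_ζ0_of_gaussCert
    (hζ : ∀ (p : B12.RunParams) (n : ℕ) (Ω Λ : ℕ → Set (Site (F.P p.K) 0)), (θ.Zh p n Ω Λ).ζ0 = (ZhPinOfRecord₁₃ θ.toStage13Params χ p Ω Λ).ζ0)
    (h : θ.Provisos₁₃CoPHChi F N χ) {n : ℕ} (s : SeqOfRecord F θ.ν θ.τ9.M (gOfRecord₁₃Chi F N θ.toStage13Params χ p) p.K n) (j : ℕ) (Y : Set (Site (F.P p.K) 0)) :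
    Measurable ((θ.zhAtChi χ p s).ζ0 j Y) := by
  rw [zhAt_ζ0_eq_rePinH θ χ p hζ s]
  exact measurable_zhAt_ζ0_rePinH_of_provisos θ χ p h s j Y

end

section
variable {F : T4Family} {N : ℕ} [NeZero N]
variable (θ : Stage13HParams F N) (χ : ChiSlot F N) (p : B12.RunParams)

/-- **MEASURABILITY OF `quad_j(Λ′)`** in the class: a finite sum of squared norms of coordinates. [cite: Balaban1988Convergent, (2.21) p.258 (bookkeeping)] -/
theorem measurable_quad_of_gaussCert
    (hq : ∀ (p : B12.RunParams) (n : ℕ) (Ω Λ : ℕ → Set (Site (F.P p.K) 0)) (j : ℕ) (Λ' : Set (Site (F.P p.K) 0)) (ω : MultiCfg (F.P p.K) (SU N) (FluctV N)),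
      (θ.Zh p n Ω Λ).quad j Λ' ω = ∑ b ∈ (Set.toFinite (bondsIn j (Λ'ᶜ ∩ Ω (j + 1)))).toFinset, ‖(ω j).2 b‖ ^ 2)
    {n : ℕ} (s : SeqOfRecord F θ.ν θ.τ9.M (gOfRecord₁₃Chi F N θ.toStage13Params χ p) p.K n) (j : ℕ) (Λ' : Set (Site (F.P p.K) 0)) :
    Measurable ((θ.zhAtChi χ p s).quad j Λ') := by
  have e : (θ.zhAtChi χ p s).quad j Λ' = fun ω => ∑ b ∈ (Set.toFinite (bondsIn j (Λ'ᶜ ∩ s.Ω (j + 1)))).toFinset, ‖(ω j).2 b‖ ^ 2 :=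
    funext fun ω => zhAt_quad_apply θ χ p hq s j Λ' ω
  rw [e]
  refine Finset.measurable_sum _ fun b _ => ?_
  have hb : Measurable fun ω : MultiCfg (F.P p.K) (SU N) (FluctV N) => (ω j).2 b :=
    (measurable_pi_apply b).comp (measurable_snd.comp (measurable_pi_apply j))
  exact (hb.norm).pow_const 2

end

end V11Append

end Summit.QuantumFields.YangMills.Theorems.BalabanUVNodesN11GaussianCertificateRowsChi

end
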